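import Summits.BirchSwinnertonDyer.BirchSwinnertonDyer.Theorems.PrintCf2RubinValueTwoEllipticUnitsLocalMeasure
import HarnessLib

/-!
# de Shalit II.4.12 at one `𝔓` for the elliptic units — the DIVISION DATA DISCHARGED: the auxiliary twists `𝔞₁ = (α₁)`, `𝔞₂ = (α₂)`
# are PRINCIPAL, `αᵢ ≡ 1 mod 𝔪`, `v(α₁ − 1) = s + 1` exactly (`s ≥ 1`), `α₂ ≡ 1 mod v^{s+1}`, `α₂ᵏ ≠ α₁ᵏ` in `K_v`

Cell `bsd-print-cf2`, width seat `bsd-line-cf2c-w4` g10; `--supports` stmt-BirchSwinnertonDyer-24721 (helper, Theses-free). THEOREMS ONLY;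
CONDITIONAL on the published named facts `DeShalit1987.prop24_ii_galoisAction`, `prop24_iii_unit`, `prop25_i_normRelation` (hypotheses of
the existence theorem, never asserted).

`exists_groupDistribution_twisting_eq_induce_ellipticUnitsLocal` (`…EllipticUnitsLocalMeasure.lean`) takes the division data of the package
VERBATIM along `rayAdicTower h𝔪 v`: `g_{𝔞ᵢ} ∈ U_s`, `g_{𝔞₁}` generates `U_s` modulo every `U_m`, its orders are unbounded powers of `2`,
`g_{𝔞₂}^k g_{𝔞₁}^{-k} ∉ ⋂ U_n`.  De Shalit (II.4.12, p. 66–68; II.4.17, p. 78) realises them with PRINCIPAL `𝔞₁ = (α₁)`, `α₁ ≡ 1 mod 𝔣`,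
`σ_{𝔞₁}` a topological generator of `Gal(K(𝔣𝔭^∞)/K(𝔣𝔭ˢ))` — i.e. `v(α₁ − 1) = s + 1` exactly, inside `1 + 4ℤ₂` at `p = 2` — and
`𝔞₂ = 𝔞̄₁`; cf2c-w4 g8 (`RayClassFieldAdicCharacterDivision.lean`) proved `hgen`/`hpow`/`hunb`/`hτ` for such Artin symbols by class
field theory (`κ_v(σ_{(α)}) = α_v⁻¹`).  THIS file plugs g8 into the one-`𝔓` assembly:

* §1 `ne_zero_of_span_singleton_eq`, `not_mem_of_isCoprime_mul` (a twist `(α)` prime to `𝔪v` has `α ≠ 0`, `α ∉ v`),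
  ★ `forall_absRestrictNormalHom_eq_artinHom_of_forall_succ` — a lift `g ∈ Gal(K̄/K(𝔪))` of the Artin symbols `((α), K(𝔪v^{m+1})/K)`,
  `m ≥ 0` (the shape `hg` of the assembly) restricts to `artinHom … ((α))` on EVERY `K(𝔪vⁿ)`, `n ≥ 0` (the shape of g8's theorems; level
  `0` is `K(𝔪)` itself, where both sides are trivial);
* §2 ★★★ `exists_groupDistribution_twisting_eq_induce_ellipticUnitsLocal_of_principal` — **the one-`𝔓` measure `μ` with
  `δ_{g_𝔠, N𝔠} μ = i(e(𝔠))` for all `𝔠 ∈ I` EXISTS as soon as the twist family contains two principal twists `𝔞₁ = (α₁)`, `𝔞₂ = (α₂)` with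
  `αᵢ ≡ 1 mod 𝔪`, `α₁ − 1 ∈ v^{s+1} ∖ v^{s+2}`, `1 ≤ s`, `α₂ − 1 ∈ v^{s+1}`, `α₂ᵏ ≠ α₁ᵏ` in `K_v` (`k > 0`), `N𝔞₁ = N𝔞₂ ≥ 2`, `4 ∣ N𝔞₁ − 1`**
  — the tower-theoretic hypotheses `hσ₁ hσ₂ hgen hpow hunb hτ` are GONE (discharged by g8's `artin_mem_rayAdicTower_U_iff`, `hgen_artin`,
  `hpow_artin`, `hunb_artin`, `hτ_artin`); only elementary arithmetic of `α₁, α₂` remains.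

HONEST FRAMING: plumbing of accepted kernel theorems; the local analytic data (`θ, j, e₂, σ₀, ε, ψ`) and the three prints stay hypotheses;
nothing here closes a crux; no summit statement is proved; BSD is not proved by any of this.

## References
* [deShalit1987] E. de Shalit, *Iwasawa theory of elliptic curves with complex multiplication* (1987), II.4.12 (p. 66–69), II.4.17 (p. 77–78).
* [NeukirchANT1999] J. Neukirch, *Algebraic Number Theory* (1999), Ch. VI §7 Thm. (7.1).
-/

-- the summit namespace `Summit.BirchSwinnertonDyer.BirchSwinnertonDyer` repeats the problem name by design (D-0017)
set_option linter.dupNamespace false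
set_option autoImplicit false

noncomputable section

open scoped Classical nonZeroDivisors
open scoped NumberField
open Field IsDedekindDomain IsDedekindDomain.HeightOneSpectrum ValuativeRel IsLocalRing MvPowerSeries
open Literature.NumberTheory.NumberFields
open Literature.NumberTheory.GaloisRepresentations Literature.NumberTheory.GaloisRepresentations.IsNonarchimedeanLocalField
  Literature.NumberTheory.GaloisRepresentations.LubinTate Literature.NumberTheory.GaloisRepresentations.ArtinLocalGlobal
  Literature.NumberTheory.PAdicHodge
open Literature.NumberTheory.EllipticCurves Literature.NumberTheory.EllipticCurves.GroupDistribution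
open Literature.NumberTheory.ComplexMultiplication.EllipticUnits
open Literature.NumberTheory.LFunctions.AbelianDensity (artinSymbol)

namespace Summit.BirchSwinnertonDyer.BirchSwinnertonDyer.Theorems.PrintCf2.EllipticUnitsLocal

variable {K : Type} [Field K] [NumberField K] {𝔪 : Ideal (𝓞 K)} {v : HeightOneSpectrum (𝓞 K)}

/-! ## §1. Principal twists: `α ≠ 0`, `α ∉ v`, and the Artin symbols on every `K(𝔪vⁿ)` -/

section Principal

omit [NumberField K] in
/-- A twist `𝔞 = (α) ≠ 0` has `α ≠ 0`. [folklore] -/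
theorem ne_zero_of_span_singleton_eq {𝔞 : Ideal (𝓞 K)} (h𝔞0 : 𝔞 ≠ ⊥) {α : 𝓞 K} (h𝔞 : 𝔞 = Ideal.span {α}) : α ≠ 0 := by
  rintro rfl
  exact h𝔞0 (by rw [h𝔞, Ideal.span_singleton_eq_bot])

omit [NumberField K] in
/-- A twist `𝔞 = (α)` prime to `𝔪v` has `α ∉ v`. [folklore] -/
theorem not_mem_of_isCoprime_mul {𝔞 : Ideal (𝓞 K)} (h𝔞c : IsCoprime 𝔞 (𝔪 * v.asIdeal)) {α : 𝓞 K} (h𝔞 : 𝔞 = Ideal.span {α}) :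
    α ∉ v.asIdeal := by
  intro hα
  have h : IsCoprime (Ideal.span {α}) v.asIdeal := (h𝔞 ▸ h𝔞c).of_mul_right_right
  rw [Ideal.isCoprime_iff_sup_eq] at h
  exact v.isPrime.ne_top (top_le_iff.mp (h ▸ sup_le ((Ideal.span_singleton_le_iff_mem _).mpr hα) le_rfl))

variable [NumberField.IsTotallyComplex K]

/-- ★ **From the assembly's `hg` to g8's `hσ`**: if `g ∈ Gal(K̄/K(𝔪))` restricts to the Artin symbol `((α), K(𝔪v^{m+1})/K)` on every
`K(𝔪v^{m+1})` (`α ≡ 1 mod 𝔪`, `α ∉ v`, `w_𝔪 = 1`), then on EVERY `K(𝔪vⁿ)`, `n ≥ 0`, it restricts to `artinHom … ((α))` — at level `0`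
both sides are `1` (`g` fixes `K(𝔪)`; `((α), K(𝔪)/K) = 1` as `α ≡ 1 mod 𝔪`). [cite: deShalit1987, II.4.12 (p. 66–67)]
[cite: NeukirchANT1999, Ch. VI §7 Thm. (7.1)] -/
theorem forall_absRestrictNormalHom_eq_artinHom_of_forall_succ (h𝔪0 : 𝔪 ≠ ⊥) (hv : ¬ 𝔪 ≤ v.asIdeal)
    (hw : ∀ u : (𝓞 K)ˣ, (u : 𝓞 K) - 1 ∈ 𝔪 → u = 1) {α : 𝓞 K} (hα0 : α ≠ 0) (hα𝔪 : α - 1 ∈ 𝔪) (hαv : α ∉ v.asIdeal)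
    {σ : absoluteGaloisGroup K} (hσ𝔪 : σ ∈ (absRestrictNormalHom (rayClassField K 𝔪)).ker)
    (hg : ∀ m : ℕ, absRestrictNormalHom (rayClassField K (𝔪 * v.asIdeal ^ (m + 1))) σ =
      artinSymbol (galFrob K (rayClassField K (𝔪 * v.asIdeal ^ (m + 1)))) (Ideal.span {α})) (n : ℕ) :
    absRestrictNormalHom (rayClassField K (𝔪 * v.asIdeal ^ n)) σ =
      artinHom (galFrob K (rayClassField K (𝔪 * v.asIdeal ^ n))) (toPrincipalIdeal (𝓞 K) K (Units.mk0 (α : K) (by exact_mod_cast hα0))) := by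
  cases n with
  | zero =>
    have hle : 𝔪 ≤ 𝔪 * v.asIdeal ^ (0 : ℕ) := by rw [pow_zero, mul_one]
    have h1 : σ ∈ (absRestrictNormalHom (rayClassField K (𝔪 * v.asIdeal ^ (0 : ℕ)))).ker :=
      ker_absRestrictNormalHom_rayClassField_anti h𝔪0 hle hσ𝔪
    rw [(MonoidHom.mem_ker).mp h1, eq_comm,
      artinHom_toPrincipalIdeal_rayClassField_mul_pow_eq_one_iff h𝔪0 hv hw hα0 hα𝔪 hαv (0 : ℕ), pow_zero, Ideal.one_eq_top]
    exact Submodule.mem_top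
  | succ m => rw [hg m, artinHom_toPrincipalIdeal_coe _ hα0]

end Principal

/-! ## §2. THE ONE-`𝔓` ASSEMBLY with the division data discharged -/

section Assembly

attribute [local instance] ltNormUniformSpace ltNormIsUniformAddGroup rk1 nF nE fintypeResidueField
attribute [local instance] RelNormCoherentUnits.instCommMonoid

variable [NumberField.IsTotallyComplex K]
  -- the prints and the global frame
  (h24ii : DeShalit1987.prop24_ii_galoisAction) (h24iii : DeShalit1987.prop24_iii_unit) (h25 : DeShalit1987.prop25_i_normRelation)
  (hK : IsImaginaryQuadratic K) (ι : K →+* ℂ)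
  (h𝔪0 : 𝔪 ≠ ⊥) (h𝔪1 : 𝔪 ≠ ⊤) (hv : ¬ 𝔪 ≤ v.asIdeal) (hw : ∀ u : (𝓞 K)ˣ, (u : 𝓞 K) - 1 ∈ 𝔪 → u = 1)
  -- the absolute Lubin–Tate model `π = u·2` at `v` and its unramified base `E`
  (hq : residueFieldCard (v.adicCompletion K) = 2)
  (h2 : (valuation (v.adicCompletion K)).IsUniformizer ((((2 : ℕ) : 𝒪[v.adicCompletion K]) : v.adicCompletion K)))
  (u : 𝒪[v.adicCompletion K]ˣ)
  {α : 𝓞 K} (hα0 : α ≠ 0) (hα𝔪 : α - 1 ∈ 𝔪) (hαw : ∀ w : HeightOneSpectrum (𝓞 K), w ≠ v → α ∉ w.asIdeal)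
  {f : ℕ} (hαπ : ((α : K) : v.adicCompletion K) =
    ((((u : 𝒪[v.adicCompletion K]) * ((2 : ℕ) : 𝒪[v.adicCompletion K]) : 𝒪[v.adicCompletion K]) : v.adicCompletion K)) ^ f)
  (E : IntermediateField (v.adicCompletion K) (AlgebraicClosure (v.adicCompletion K)))
  [FiniteDimensional (v.adicCompletion K) E] [IsGalois (v.adicCompletion K) E] (hE : E ≤ maxUnramified (v.adicCompletion K))
  (hdegE : ∀ w : WeilGroup (v.adicCompletion K),
    WeilGroup.toAbsGalois (v.adicCompletion K) w ∈ E.fixingSubgroup → (f : ℤ) ∣ WeilGroup.deg w)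
  -- the local analytic data: arithmetic Frobenius, the unit `ε`, the reading `θ : ℂ_{K_v} → ℂ₂`, `j : 𝒪_E → 𝐃`, `e₂ : 𝒪_v ≃ ℤ₂`
  {σ₀ : absoluteGaloisGroup (v.adicCompletion K)} (hσ₀ : IsAbsArithFrob σ₀)
  {ε : (maxUnramifiedCompletion (v.adicCompletion K))ˣ}
  (hε : maxUnramifiedCompletion.galAut (v.adicCompletion K) σ₀ (ε : maxUnramifiedCompletion (v.adicCompletion K)) =
    algebraMap 𝒪[v.adicCompletion K] (maxUnramifiedCompletion (v.adicCompletion K)) (u : 𝒪[v.adicCompletion K]) *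
      (ε : maxUnramifiedCompletion (v.adicCompletion K)))
  (θ : CompletedAlgClosure (v.adicCompletion K) →+* ℂ_[2])
  (hθ1 : ∀ z : CBall (v.adicCompletion K), ‖θ (z : CompletedAlgClosure (v.adicCompletion K))‖ ≤ 1)
  (j : unitBall E →+* UnrCoeff (v.adicCompletion K))
  (hj : j.comp (algebraMap (LTCoeff (v.adicCompletion K)) (unitBall E)) =
    (intToUnrCoeff (v.adicCompletion K)).comp (LTCoeff.of (v.adicCompletion K)).symm.toRingHom)
  (hjC : (algebraMap (UnrCoeff (v.adicCompletion K)) (CBall (v.adicCompletion K))).comp j = unitBallToCBall E)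
  (e₂ : v.adicCompletionIntegers K ≃+* ℤ_[2])
  (hΘe : ∀ a : 𝒪[v.adicCompletion K], (θ.comp ((CBall (v.adicCompletion K)).subtype.comp
      (algebraMap (UnrCoeff (v.adicCompletion K)) (CBall (v.adicCompletion K))))) (intToUnrCoeff (v.adicCompletion K) a) =
    padicIntCast ℂ_[2] (((e₂ : v.adicCompletionIntegers K →+* ℤ_[2]).comp
      (integerEquivAdicCompletionIntegers v).toRingHom) a))
  -- the cell maps of the tower `K(𝔪v^{n+1})` for `κ := κ_v⁻¹` read in `ℤ₂`
  (ψ : (n : ℕ) → ↥(absRestrictNormalHom (rayClassField K 𝔪)).ker ⧸ (rayAdicTower (𝔪 := 𝔪) h𝔪0 v).U n → ZMod (2 ^ (n + 1)))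
  (hψ : ∀ (n : ℕ) (g : ↥(absRestrictNormalHom (rayClassField K 𝔪)).ker), g ∈ (rayAdicTower (𝔪 := 𝔪) h𝔪0 v).U 0 →
    ψ n ((rayAdicTower (𝔪 := 𝔪) h𝔪0 v).proj n g) =
      PadicInt.toZModPow (n + 1) ((((Units.map (e₂ : v.adicCompletionIntegers K →+* ℤ_[2]).toMonoidHom).comp
        (rayAdicCharacter h𝔪0 hv hw))⁻¹ g : ℤ_[2]ˣ) : ℤ_[2]))
  -- the twists: ideals `𝔠` prime to `𝔪v`, Galois lifts `g_𝔠 ∈ Gal(K̄/K(𝔪))` of their Artin symbols, elliptic-unit families under `Θ(1; 𝔪v^{m+1}, 𝔠)`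
  {I : Type*} (idl : I → Ideal (𝓞 K)) (hidl0 : ∀ i, idl i ≠ ⊥) (hidlc : ∀ i, IsCoprime (idl i) (𝔪 * v.asIdeal))
  (g : I → ↥(absRestrictNormalHom (rayClassField K 𝔪)).ker)
  (hg : ∀ (i : I) (m : ℕ), absRestrictNormalHom (rayClassField K (𝔪 * v.asIdeal ^ (m + 1))) (g i : absoluteGaloisGroup K) =
    artinSymbol (galFrob K (rayClassField K (𝔪 * v.asIdeal ^ (m + 1)))) (idl i))
  (x : ∀ (i : I) (m : ℕ), rayClassField K (𝔪 * v.asIdeal ^ (m + 1)))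
  (hx : ∀ (i : I) (m : ℕ), IsThetaValueOne ι (𝔪 * v.asIdeal ^ (m + 1)) (idl i)
    (algClosureEmb ι ((x i m : rayClassField K (𝔪 * v.asIdeal ^ (m + 1))) : AlgebraicClosure K)))

set_option maxHeartbeats 800000 in
include h24ii hq hj hjC hΘe hg in
/-- ★★★ **de Shalit II.4.12 at one `𝔓`-component for the elliptic units, DIVISION DATA DISCHARGED.**  In the setting of
`exists_groupDistribution_twisting_eq_induce_ellipticUnitsLocal` (`K` imaginary quadratic, `𝔪 ≠ 0`, `v ∤ 𝔪`, `w_𝔪 = 1`; the absolute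
Lubin–Tate model `π = u·2`, `α = π^f`; the unramified Galois base `E`; local analytic data `σ₀, ε, θ, j, e₂`; cell maps `ψ` for `κ_v⁻¹`; twists
`𝔠 ∈ I` prime to `𝔪v` with lifts `g_𝔠 ∈ Gal(K̄/K(𝔪))` of their Artin symbols and elliptic-unit families `x^𝔠`), GIVEN II.2.4 (ii)/(iii) and
II.2.5 (i) as named facts: if the family contains two PRINCIPAL twists `𝔞₁ = (α₁)`, `𝔞₂ = (α₂)` with `αᵢ ≡ 1 mod 𝔪`,
`α₁ − 1 ∈ v^{s+1} ∖ v^{s+2}`, `1 ≤ s` (de Shalit's "`σ_{𝔞₁}` a topological generator of `Gal(K(𝔣𝔭^∞)/K(𝔣𝔭ˢ))`", inside `1 + 4ℤ₂`),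
`α₂ − 1 ∈ v^{s+1}`, `α₂ᵏ ≠ α₁ᵏ` in `K_v` for all `k > 0` (e.g. `α₂ = ᾱ₁` with `α₁/ᾱ₁` not a root of unity), and `N𝔞₁ = N𝔞₂ ≥ 2`,
`4 ∣ N𝔞₁ − 1`, then **there is a bounded distribution `μ` on `Gal(K̄/K(𝔪))` along `K(𝔪v^{n+1})`, `‖μ‖ = 1`, with `δ_{g_𝔠, N𝔠} μ = i(e(𝔠))`
levelwise for every `𝔠 ∈ I`** — the hypotheses `hσ₁ hσ₂ hgen hpow hunb hτ` of the assembly discharged by cf2c-w4 g8's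
`artin_mem_rayAdicTower_U_iff`, `hgen_artin`, `hpow_artin`, `hunb_artin`, `hτ_artin`.
[cite: deShalit1987, II.4.12 (p. 66–69), II.4.17 (p. 77–78)] [cite: NeukirchANT1999, Ch. VI §7 Thm. (7.1)] -/
theorem exists_groupDistribution_twisting_eq_induce_ellipticUnitsLocal_of_principal
    [hN : ∀ n, ((rayAdicTower (𝔪 := 𝔪) h𝔪0 v).U n).Normal]
    {s : ℕ} (hs : 1 ≤ s) (a₁ a₂ : I) {α₁ α₂ : 𝓞 K} (ha₁ : idl a₁ = Ideal.span {α₁}) (ha₂ : idl a₂ = Ideal.span {α₂})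
    (hα₁𝔪 : α₁ - 1 ∈ 𝔪) (hα₂𝔪 : α₂ - 1 ∈ 𝔪)
    (hs₁ : α₁ - 1 ∈ v.asIdeal ^ (s + 1)) (hs₁' : α₁ - 1 ∉ v.asIdeal ^ (s + 2)) (hs₂ : α₂ - 1 ∈ v.asIdeal ^ (s + 1))
    (hne : ∀ k : ℕ, 0 < k → ((α₂ : K) : v.adicCompletion K) ^ k ≠ ((α₁ : K) : v.adicCompletion K) ^ k)
    (hN1 : 2 ≤ Ideal.absNorm (idl a₁)) (h4 : 4 ∣ Ideal.absNorm (idl a₁) - 1) (hN12 : Ideal.absNorm (idl a₂) = Ideal.absNorm (idl a₁)) :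
    letI := rayAction h𝔪0 hv hw (isUniformizer_unit_mul h2 u) E hE
    ∃ μ : GroupDistribution (rayAdicTower (𝔪 := 𝔪) h𝔪0 v) ℂ_[2], μ.bound = 1 ∧
      ∀ (c : I) (n : ℕ) (b : ↥(absRestrictNormalHom (rayClassField K 𝔪)).ker ⧸ (rayAdicTower (𝔪 := 𝔪) h𝔪0 v).U n),
        (twisting (g c) (Ideal.absNorm (idl c) : ℂ_[2]) μ).μ n b =
        (GroupDistribution.induce
          (fun β : RelNormCoherentUnits (isUniformizer_unit_mul h2 u) E ↦
            (GroupDistribution.comap (restrictUnits ((invAmice₁ 2 ((PowerSeries.subst (compSeriesC h2 hσ₀ u hε)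
              ((relTildeSeries (isUniformizer_unit_mul h2 u) E hq hE hσ₀
                (LTCoeff.of (v.adicCompletion K) (u : 𝒪[v.adicCompletion K])) β).map j)).map
              (θ.comp ((CBall (v.adicCompletion K)).subtype.comp
                (algebraMap (UnrCoeff (v.adicCompletion K)) (CBall (v.adicCompletion K))))))
              (norm_coeff_relSeries_le_one hq h2 u E hE hσ₀ hε θ hθ1 j hjC β)).density
              (ProfiniteTower.padicInt_isUniform 2) (unitInv ℂ_[2]) uniformContinuous_unitInv norm_unitInv_le))
              ψ ((rayAdicTower (𝔪 := 𝔪) h𝔪0 v).cellMap_trans (((Units.map (e₂ : v.adicCompletionIntegers K →+* ℤ_[2]).toMonoidHom).comp (rayAdicCharacter h𝔪0 hv hw))⁻¹) ψ hψ)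
              ((rayAdicTower (𝔪 := 𝔪) h𝔪0 v).cellMap_injective (((Units.map (e₂ : v.adicCompletionIntegers K →+* ℤ_[2]).toMonoidHom).comp (rayAdicCharacter h𝔪0 hv hw))⁻¹)
                (mem_rayAdicTower_iff_inv h𝔪0 h𝔪0 hv hw e₂ le_rfl hv) ψ hψ)
              ((rayAdicTower (𝔪 := 𝔪) h𝔪0 v).cellMap_fiberSurj (((Units.map (e₂ : v.adicCompletionIntegers K →+* ℤ_[2]).toMonoidHom).comp (rayAdicCharacter h𝔪0 hv hw))⁻¹)
                (mem_rayAdicTower_iff_inv h𝔪0 h𝔪0 hv hw e₂ le_rfl hv)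
                (exists_toZModPow_padicRayAdicCharacter_inv_eq h𝔪0 h𝔪0 hv hw e₂ le_rfl hv) ψ hψ)))
          zero_le_one (fun _ ↦ le_rfl)
          (ellipticUnitsLocal h24iii h25 hK ι h𝔪0 h𝔪1 hv hw (isUniformizer_unit_mul h2 u) hα0 hα𝔪 hαw hαπ E hE hdegE
            (hidl0 c) (hidlc c) (x c) (hx c))).μ n b := by
  -- the two principal twists: `αᵢ ≠ 0`, `αᵢ ∉ v`, and g8's `hσ`-shape on every `K(𝔪vⁿ)`
  have hα0₁ : α₁ ≠ 0 := ne_zero_of_span_singleton_eq (hidl0 a₁) ha₁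
  have hα0₂ : α₂ ≠ 0 := ne_zero_of_span_singleton_eq (hidl0 a₂) ha₂
  have hαv₁ : α₁ ∉ v.asIdeal := not_mem_of_isCoprime_mul (hidlc a₁) ha₁
  have hαv₂ : α₂ ∉ v.asIdeal := not_mem_of_isCoprime_mul (hidlc a₂) ha₂
  have hσ := forall_absRestrictNormalHom_eq_artinHom_of_forall_succ h𝔪0 hv hw hα0₁ hα₁𝔪 hαv₁ (g a₁).2
    (fun m ↦ by rw [hg a₁ m, ha₁])
  have hτ' := forall_absRestrictNormalHom_eq_artinHom_of_forall_succ h𝔪0 hv hw hα0₂ hα₂𝔪 hαv₂ (g a₂).2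
    (fun m ↦ by rw [hg a₂ m, ha₂])
  have hσ₁ : g a₁ ∈ (rayAdicTower (𝔪 := 𝔪) h𝔪0 v).U s :=
    (artin_mem_rayAdicTower_U_iff h𝔪0 hv hw hα0₁ hα₁𝔪 hαv₁ hσ (g a₁).2 s).mpr hs₁
  have hσ₂ : g a₂ ∈ (rayAdicTower (𝔪 := 𝔪) h𝔪0 v).U s :=
    (artin_mem_rayAdicTower_U_iff h𝔪0 hv hw hα0₂ hα₂𝔪 hαv₂ hτ' (g a₂).2 s).mpr hs₂
  have hp2 : (2 : ℕ) = 2 → 1 ≤ s := fun _ ↦ hs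
  exact exists_groupDistribution_twisting_eq_induce_ellipticUnitsLocal h24ii h24iii h25 hK ι h𝔪0 h𝔪1 hv hw hq h2 u hα0 hα𝔪 hαw hαπ
    E hE hdegE hσ₀ hε θ hθ1 j hj hjC e₂ hΘe ψ hψ idl hidl0 hidlc g hg x hx a₁ a₂ hσ₁ hσ₂
    (hgen_artin h𝔪0 h𝔪0 hv hw e₂ le_rfl hv hα0₁ hα₁𝔪 hαv₁ hσ (g a₁).2 hs₁ hs₁' hp2)
    (hpow_artin h𝔪0 h𝔪0 hv hw e₂ le_rfl hv hα0₁ hα₁𝔪 hαv₁ hσ (g a₁).2 hs₁ hs₁' hp2)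
    (hunb_artin h𝔪0 h𝔪0 hv hw e₂ le_rfl hv hα0₁ hα₁𝔪 hαv₁ hσ (g a₁).2 hs₁ hs₁' hp2)
    hN1 h4 hN12
    (hτ_artin h𝔪0 h𝔪0 hv hw e₂ le_rfl hv hα0₁ hα₁𝔪 hαv₁ hα0₂ hα₂𝔪 hαv₂ hσ hτ' (g a₁).2 (g a₂).2 hne s)

end Assembly

end Summit.BirchSwinnertonDyer.BirchSwinnertonDyer.Theorems.PrintCf2.EllipticUnitsLocal

end
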